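import Literature.AlgebraicGeometry.Resolution.AlterationsLemma411Vertex
import Literature.AlgebraicGeometry.Resolution.AlterationsLemma411Blowup
import Literature.AlgebraicGeometry.Resolution.AlterationsLemma411FibreDimension
import Literature.AlgebraicGeometry.Resolution.AlterationsLemma411SmoothLocus
import Literature.AlgebraicGeometry.Resolution.AlterationsFibresConnected
import Literature.AlgebraicGeometry.FundamentalGroup.ProjectiveSpace
import Literature.AlgebraicGeometry.Resolution.AlterationsBlowupDivisorProofs
import Literature.AlgebraicGeometry.Resolution.AlterationsModelExtension
import Literature.AlgebraicGeometry.Resolution.AlterationsThreeBlocks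
import Literature.AlgebraicGeometry.Resolution.AlterationsMultisection
import Literature.AlgebraicGeometry.Resolution.AlterationsPreSemiStable
import Literature.AlgebraicGeometry.Resolution.AlterationsSections
import Literature.AlgebraicGeometry.Resolution.AlterationsMultisectionLocal
import Literature.AlgebraicGeometry.Resolution.AlterationsMultisectionEtaleNhdProofs
import Literature.AlgebraicGeometry.Resolution.AlterationsStrictTransformHolds
import Literature.AlgebraicGeometry.Resolution.AlterationsStrictTransformConsequences
import Literature.AlgebraicGeometry.Resolution.AlterationsRationalMapExtension
import Literature.AlgebraicGeometry.Resolution.LiuFlatIntegral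
import Literature.AlgebraicGeometry.Resolution.AlterationsNormalForm
import Literature.AlgebraicGeometry.Resolution.AlterationsNormalFormLeaves
import Literature.AlgebraicGeometry.Resolution.AlterationsFormalNodesSingProofs
import Literature.AlgebraicGeometry.Resolution.AlterationsSingularComponentsProofs
import Literature.AlgebraicGeometry.Resolution.WeakJacobianMizutaniProof
import Literature.AlgebraicGeometry.Resolution.AlterationsCodimThreeAssembly
import Literature.AlgebraicGeometry.Resolution.FormalNormalCrossingsEtale
import Literature.AlgebraicGeometry.Resolution.ArtinApproximationProofs
import Literature.AlgebraicGeometry.Resolution.AlterationsSemiStableResolutionProofs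
import Literature.AlgebraicGeometry.Resolution.AlterationsNormalFormBlowupChartsFormal
import Literature.AlgebraicGeometry.Resolution.AlterationsNormalFormCentreFormalIdealProofs
import Literature.AlgebraicGeometry.Resolution.AlterationsNormalFormStrictTransformProofs
import Literature.AlgebraicGeometry.Resolution.AlterationsDescentLimit3
import HarnessLib

/-!
# De Jong's alteration theorem over algebraically closed fields from its current leaves

Topic: `Literature/AlgebraicGeometry/Resolution`. Bookkeeping for the owning unit of
`DeJong1996StrongAlgClosed` (de Jong 1996, Thm. 4.1 with its generically-étale clause over
algebraically closed fields, `AlterationsStrong.lean`). The printed proof 4.3–4.28 has been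
decomposed across the Literature along its own numbering; 4.3, 4.4, 4.6–4.10, the induction on
`dim X`, 4.14–4.15 (strict transforms), 4.22 and large parts of 4.11, 4.24 and 4.26–4.27 are
PROVED. This file assembles, in ONE implication per printed block and one for the theorem, the
named facts that are still open below it — so that the trust base of
`DeJong1996StrongAlgClosed` can be read off a single declaration:

* `DeJong1996FibrationReduction.of_printedLeaves` — **4.11–4.12** (fibring a normal projective
  pair in curves over `ℙ^d`) from: the generic projection `π : X → ℙ^{d+1}` of the proof of
  Lemma 4.11 with its Bertini conclusions, normalised at the vertex, and the blow-up of
  `ℙ^{d+1}` in the vertex with its projection to `ℙ^d` (`DeJong1996Lemma411VertexChoice`,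
  `DeJong1996VertexBlowupProjection`; the rest of the construction of 4.11 — the blow-up of `X`
  in `π⁻¹(p)`, the fibre dimension, the density of the smooth locus — is proved), 2.8 in the form "one smooth fibre ⇒ smooth over a non-empty
  open" (`DeJong1996SmoothOverOpen`), Zariski's connectedness theorem for the Stein
  factorisation (`steinFactorization_geometricallyConnected`, Stacks 03H0 (1)), finiteness and
  étaleness of the finite part of the Stein factorisation of `f` (`DeJong1996SteinFactorizationEtale`),
  and `π₁(ℙ^r) = 0` (SGA 1 XI 1.1) through `π₁(ℙ¹) = 0` and the connectedness of hyperplane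
  sections of étale covers (`ProjectiveLineSimplyConnected`, `EtaleCoverHyperplaneSectionConnected`).
* `DeJong1996SemiStablePairResolution.of_printedLeaves` — **4.23–4.28** (resolution of a
  semi-stable pair) from: the local structure of the nodes of a semi-stable curve over a regular
  base degenerating along a strict normal crossings divisor, at closed points and at the generic
  points of the codimension-2 singular components (2.23/3.3: `DeJong1996NodeLocalStructure`,
  `DeJong1996NodeLocalStructureCodimTwo`), the Claim of 3.4 for one blow-up
  (`DeJong1996SemiStableCodimTwoBlowupCore`), general Néron desingularisation
  (`Popescu1986_generalNeronDesingularization`, giving Artin approximation and with it "formal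
  normal crossings ⇒ normal crossings" in 4.28), the two formal chart computations of 4.27
  (`DeJong1996NodalBlowupSingularLocus`, `DeJong1996NodalBlowupFormalCharts`) and the blow-up
  of the top stratum of a normal crossings divisor (2.4: `SNCBlowupTopStratum`).
* `DeJong1996FibrationToSemiStablePair.of_printedLeaves` — **4.13–4.22** (from a fibration in
  curves to a semi-stable pair) from: the hyperplane multisection (4.13:
  `DeJong1996MultisectionHyperplane`), Galois normalisation (4.16: `DeJong1996GaloisNormalization`),
  the stable extension over a generically étale alteration of the base via `M̄_{g,n}` with level
  structure (4.17 with 2.24: `DeJong1996StableExtension`), and the extension of the rational map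
  `β : 𝒞 ⇢ X` after a modification of the base (4.18–4.21 with 2.19:
  `DeJong1996RationalMapExtension`); 4.14–4.15 and 4.22 are proved
  (`DeJong1996StrictTransform_holds`, `DeJong1996PreSemiStablePairToSemiStablePair_holds`).
* `DeJong1996StrongAlgClosed.of_printedLeaves` — **Thm. 4.1 over algebraically closed fields**
  from the three blocks above (`DeJong1996StrongAlgClosed.of_threeBlocks`, `AlterationsThreeBlocks.lean`),
  and `DeJong1996Strong.of_printedLeaves` — Thm. 4.1 (i)+(ii) over every field, its last sentence
  over perfect fields, `DeJong1996Projective` and the weak form `DeJong1996`, the limit argument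
  of 4.5 being proved (`DeJong1996Descent_holds`).

Eighteen named facts in all, each a published result with its own locator; the
theorems below are pure compositions of assemblies already in the tree, fed with every
discharge (`…_holds`) available.

## Sources

* A. J. de Jong, *Smoothness, semi-stability and alterations*, Publ. Math. IHÉS 83 (1996) 51–93:
  Thm. 4.1 and its proof 4.3–4.28 (pp. 66–76), 2.4, 2.8, 2.19, 2.23–2.24, 3.2–3.5.
-/

noncomputable section

open CategoryTheory AlgebraicGeometry

namespace Literature.AlgebraicGeometry.Resolution

universe u

open Literature.AlgebraicGeometry.Morphisms Literature.AlgebraicGeometry.FundamentalGroup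

/-- **4.11–4.12 from its open leaves** (see the module docstring): Lemma 4.11 through the generic
projection normalised at the vertex and the blow-up of `ℙ^{d+1}` in the vertex (the blow-up of
`X`, the fibre dimension and the density of the smooth locus are proved), 2.8, Stein
factorisation (Zariski connectedness; finiteness and étaleness of the finite part) and
`π₁(ℙ^r_k) = 0` via `ℙ¹` and hyperplane sections.
[cite: DeJong1996, Lemma 4.11 and 4.12, pp. 67–69] -/
theorem DeJong1996FibrationReduction.of_printedLeaves
    (hV : DeJong1996VertexBlowupProjection.{u}) (hC : DeJong1996Lemma411VertexChoice.{u})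
    (h28 : DeJong1996SmoothOverOpen.{u}) (hZ : steinFactorization_geometricallyConnected.{u})
    (hE : DeJong1996SteinFactorizationEtale.{u}) (hP1 : ProjectiveLineSimplyConnected.{u})
    (hH : EtaleCoverHyperplaneSectionConnected.{u}) : DeJong1996FibrationReduction.{u} :=
  DeJong1996FibrationReduction.of_lemma411_of_steinEtale BlowupProjectiveOverField_holds
    (DeJong1996Lemma411.of_vertexBlowupProjection_of_vertexChoice_of_construction hV hC
      DeJong1996Lemma411Blowup_holds DeJong1996Lemma411FibreDimension_holds
      DeJong1996Lemma411SmoothLocusDense_holds)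
    h28 hZ hE (ProjectiveSpaceSimplyConnected.of_projectiveLine_of_hyperplaneSection hP1 hH)

/-- **4.13–4.22 from its open leaves**: the hyperplane multisection (4.13), Galois normalisation
(4.16), the stable extension via the level-`ℓ` moduli scheme of stable pointed curves (4.17) and
the extension of `β : 𝒞 ⇢ X` after a modification of the base (4.18–4.21); the local and
generically-étale parts of 4.13, the strict transforms of 4.14–4.15 and the pull-back 4.22 are
proved. [cite: DeJong1996, 4.13–4.22, pp. 69–75] -/
theorem DeJong1996FibrationToSemiStablePair.of_printedLeaves
    (h13 : DeJong1996MultisectionHyperplane.{u}) (h16 : DeJong1996GaloisNormalization.{u})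
    (h17 : DeJong1996StableExtension.{u}) (h18 : DeJong1996RationalMapExtension.{u}) :
    DeJong1996FibrationToSemiStablePair.{u} :=
  DeJong1996FibrationToSemiStablePair.of_multisection_of_toSemiStablePair
    (DeJong1996MultisectionReduction.of_multisectionLocal (DeJong1996MultisectionLocal.of_hyperplane h13))
    (DeJong1996MultisectionToSemiStablePair.of_toPre_of_preToSemiStable
      (DeJong1996MultisectionToPreSemiStablePair.of_sections_of_toPre
        (DeJong1996SectionsReduction.of_galoisNormalization h16)
        (DeJong1996SectionsToPreSemiStablePair.of_stableModel_of_extensionReduction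
          (DeJong1996StableModelReduction.of_stableExtension h17)
          (DeJong1996ModelExtensionReduction.of_rationalMapExtension_of_strictTransform h18
            DeJong1996StrictTransform_holds)))
      DeJong1996PreSemiStablePairToSemiStablePair_holds)

/-- **4.24 from its open leaves**: the node structure at closed points and at the generic points
of the codimension-2 singular components (2.23/3.3) and the Claim of 3.4; the G-ring input
(polynomial rings over a field, Matsumura Thm. 32.6 Cor.) is proved.
[cite: DeJong1996, 4.24 with Lemma 3.2 and 3.5, p. 75] -/
theorem DeJong1996SemiStablePairNormalForm.of_printedLeaves
    (hN : DeJong1996NodeLocalStructure.{u}) (hN₂ : DeJong1996NodeLocalStructureCodimTwo.{u})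
    (hK : DeJong1996SemiStableCodimTwoBlowupCore.{u}) : DeJong1996SemiStablePairNormalForm.{u} :=
  DeJong1996SemiStablePairNormalForm.of_leaves hN₂ (DeJong1996SemiStableCodimTwoBlowupCentre.of_core hK)
    (DeJong1996SplitNodalStructure.of_nodeLocalStructure hN) Matsumura1987_32_polynomial_holds
    (DeJong1996CodimThreeSingularComponentsFormal.of_splitNodal_of_polynomial
      (DeJong1996SplitNodalStructure.of_nodeLocalStructure hN) Matsumura1987_32_polynomial_holds)

/-- **4.25–4.28 from its open leaves**: general Néron desingularisation (for Artin approximation,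
hence "formal normal crossings are normal crossings"), the two formal chart computations of 4.27
and the blow-up of the top stratum (2.4); projectivity of blow-ups, the formal ideal of the
centre, the intersection of the centres and the strict-transform closed immersion are proved.
[cite: DeJong1996, 4.25–4.28, pp. 75–76] -/
theorem DeJong1996NormalFormPairResolution.of_printedLeaves
    (hP : Popescu1986_generalNeronDesingularization.{u}) (hS : DeJong1996NodalBlowupSingularLocus.{u})
    (hF : DeJong1996NodalBlowupFormalCharts.{u}) (hT : SNCBlowupTopStratum.{u}) :
    DeJong1996NormalFormPairResolution.{u} :=
  DeJong1996NormalFormPairResolution.of_liveLeaves DeJong1996NormalFormPairCentreFormalIdeal_holds hS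
    DeJong1996NormalFormPairCentreIntersection_holds StrictTransformClosedImmersion_holds
    (DeJong1996NormalFormPairBlowupChartsOverCentre.of_centreFormalIdeal_of_formalCharts
      DeJong1996NormalFormPairCentreFormalIdeal_holds hF)
    (DeJong1996FormalNormalCrossings.of_artinApproximation
      (Artin1969EtaleApproximation.of_generalNeronDesingularization hP Matsumura1987_32_6_cor_holds))
    (DeJong1996NormalCrossingsBlowup.of_sncBlowupTopStratum hT) BlowupProjectiveOverField_holds

/-- **4.23–4.28 from its open leaves** (4.24 and 4.25–4.28 as above).
[cite: DeJong1996, 4.23–4.28, pp. 75–76] -/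
theorem DeJong1996SemiStablePairResolution.of_printedLeaves
    (hN : DeJong1996NodeLocalStructure.{u}) (hN₂ : DeJong1996NodeLocalStructureCodimTwo.{u})
    (hK : DeJong1996SemiStableCodimTwoBlowupCore.{u})
    (hP : Popescu1986_generalNeronDesingularization.{u}) (hS : DeJong1996NodalBlowupSingularLocus.{u})
    (hF : DeJong1996NodalBlowupFormalCharts.{u}) (hT : SNCBlowupTopStratum.{u}) :
    DeJong1996SemiStablePairResolution.{u} :=
  DeJong1996SemiStablePairResolution.of_normalForm
    (DeJong1996SemiStablePairNormalForm.of_printedLeaves hN hN₂ hK)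
    (DeJong1996NormalFormPairResolution.of_printedLeaves hP hS hF hT)

/-- **`DeJong1996StrongAlgClosed` — de Jong 1996, Thm. 4.1 with its generically-étale clause over
algebraically closed fields — from the eighteen named facts currently open below it** (module
docstring): seven for 4.11–4.12, four for 4.13–4.22 (4.13, 4.16, 4.17, 4.18–4.21; 4.14–4.15 and
4.22 proved), seven for 4.23–4.28; everything else of the printed proof (4.3–4.10, the
induction, the glue of 4.12–4.28) is proved in the tree.
[cite: DeJong1996, Thm. 4.1 and 4.3–4.28, pp. 66–76] -/
theorem DeJong1996StrongAlgClosed.of_printedLeaves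
    -- 4.11–4.12
    (hV : DeJong1996VertexBlowupProjection.{u}) (hC : DeJong1996Lemma411VertexChoice.{u})
    (h28 : DeJong1996SmoothOverOpen.{u}) (hZ : steinFactorization_geometricallyConnected.{u})
    (hE : DeJong1996SteinFactorizationEtale.{u}) (hP1 : ProjectiveLineSimplyConnected.{u})
    (hH : EtaleCoverHyperplaneSectionConnected.{u})
    -- 4.13–4.22
    (h13 : DeJong1996MultisectionHyperplane.{u}) (h16 : DeJong1996GaloisNormalization.{u})
    (h17 : DeJong1996StableExtension.{u}) (h18 : DeJong1996RationalMapExtension.{u})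
    -- 4.23–4.28
    (hN : DeJong1996NodeLocalStructure.{u}) (hN₂ : DeJong1996NodeLocalStructureCodimTwo.{u})
    (hK : DeJong1996SemiStableCodimTwoBlowupCore.{u})
    (hP : Popescu1986_generalNeronDesingularization.{u}) (hS : DeJong1996NodalBlowupSingularLocus.{u})
    (hF : DeJong1996NodalBlowupFormalCharts.{u}) (hT : SNCBlowupTopStratum.{u}) :
    DeJong1996StrongAlgClosed.{u} :=
  DeJong1996StrongAlgClosed.of_threeBlocks
    (DeJong1996FibrationReduction.of_printedLeaves hV hC h28 hZ hE hP1 hH)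
    (DeJong1996FibrationToSemiStablePair.of_printedLeaves h13 h16 h17 h18)
    (DeJong1996SemiStablePairResolution.of_printedLeaves hN hN₂ hK hP hS hF hT)

/-- The same eighteen leaves give Thm. 4.1 (i)+(ii) over every field and its last sentence over
perfect fields, the limit argument of 4.5 being proved (`DeJong1996Descent_holds`), hence also
Thm. 4.1 (i) (`DeJong1996Projective`) and the weak form `DeJong1996` (an alteration with regular
source). [cite: DeJong1996, Thm. 4.1, p. 66] -/
theorem DeJong1996Strong.of_printedLeaves
    (hV : DeJong1996VertexBlowupProjection.{u}) (hC : DeJong1996Lemma411VertexChoice.{u})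
    (h28 : DeJong1996SmoothOverOpen.{u}) (hZ : steinFactorization_geometricallyConnected.{u})
    (hE : DeJong1996SteinFactorizationEtale.{u}) (hP1 : ProjectiveLineSimplyConnected.{u})
    (hH : EtaleCoverHyperplaneSectionConnected.{u})
    (h13 : DeJong1996MultisectionHyperplane.{u}) (h16 : DeJong1996GaloisNormalization.{u})
    (h17 : DeJong1996StableExtension.{u}) (h18 : DeJong1996RationalMapExtension.{u})
    (hN : DeJong1996NodeLocalStructure.{u}) (hN₂ : DeJong1996NodeLocalStructureCodimTwo.{u})
    (hK : DeJong1996SemiStableCodimTwoBlowupCore.{u})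
    (hP : Popescu1986_generalNeronDesingularization.{u}) (hS : DeJong1996NodalBlowupSingularLocus.{u})
    (hF : DeJong1996NodalBlowupFormalCharts.{u}) (hT : SNCBlowupTopStratum.{u}) :
    DeJong1996Strong.{u} ∧ DeJong1996StrongPerfect.{u} ∧ DeJong1996Projective.{u} ∧ DeJong1996.{u} :=
  have h := DeJong1996Descent_holds (DeJong1996StrongAlgClosed.of_printedLeaves hV hC h28 hZ hE hP1
    hH h13 h16 h17 h18 hN hN₂ hK hP hS hF hT)
  ⟨h.1, h.2, h.1.projective, h.1.deJong1996⟩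

end Literature.AlgebraicGeometry.Resolution

end
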